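import Summits.ValiantsHypothesis.ValiantsHypothesis.Theorems.GrenetZeonPolySizeQPAlgebraDepthAxis
import Summits.ValiantsHypothesis.ValiantsHypothesis.Theorems.GrenetZeonPolySizeQPAlgebraDegreeFloor
import HarnessLib

/-!
# A shallow abelianization is a sum of determinants (depth reading of stmt-ValiantsHypothesis-8063)

Helper file for the piece `AbelianizationQP` (stmt-8063, line `zeon-window`; open stub
`stub_subexpAbelianization` ≡ the crux, `abelianizationQP_iff_subexpAbelianization`).  The crux asks
to trade an affine determinantal expression of `per_n` of size `m` for an
`(n^c + c, 2^((log₂ m + c)^c))`-representation over SOME commutative coefficient algebra `R`.  By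
the semisimplification theorem `eq_sum_dets_of_depth` (file
`GrenetZeonPolySizeQPAlgebraShallowSemisimple.lean`), if that algebra is LOCAL of polylogarithmic
Loewy depth `(ker φ)^((log₂ m + c)^c) = 0`, the representation is nothing but a
`2^((log₂ m + 2c + 4)^(2c + 4))`-long linear combination of affine determinants of size `n^c + c`
over `ℂ` itself.

## Main result

* `sum_dets_of_shallow_algRepr` — the statement above (`n ≤ m`, which holds for every
  determinantal expression of `per_n` by the degree floor).  Census reading for the planner: the
  abelianization posited by the crux must be DEEP (depth beyond polylog `m` — as the zeon algebra,
  depth `n + 1`, and the Landsberg–Ressayre apolar algebra are), unless subexponential determinantal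
  expressions of the permanent «ΣDet-reduce»: size `m` ⟹ a `2^(polylog m)`-long sum of
  `poly(n)`-size determinants — a depth-reduction statement not known for any polynomial family.

No stub is closed; `VP ≠ VNP` is not touched.

## References

* P. Hrubeš, A. Yehudayoff, *Arithmetic complexity in ring extensions*, Theory of Computing 7
  (2011), §2. [cite: HrubesYehudayoff2011, §2]
-/

set_option linter.dupNamespace false

noncomputable section

namespace Summit.ValiantsHypothesis.ValiantsHypothesis.Theorems.GrenetZeonAbelianizationQP

open MvPolynomial Matrix
open Literature.Computability.AlgebraicComplexity
open Summit.ValiantsHypothesis.ValiantsHypothesis.Theses.GrenetZeon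
open Summit.ValiantsHypothesis.ValiantsHypothesis.Theorems.GrenetZeonPolySizeQPAlgebra

/-- **A shallow quasi-polynomial abelianization is a quasi-polynomial sum of polynomial-size
determinants.**  Let `n ≤ m` and suppose `per_n = λ(det A)` coefficientwise for an affine matrix `A`
of size `n^c + c` over a local commutative coefficient algebra `R` (character `φ`) with
`dim R ≤ s ≤ 2^((log₂ m + c)^c)` and depth `(ker φ)^((log₂ m + c)^c) = 0`.  Then
`per_n = Σ_{q<G} α_q det B_q` with affine `B_q` of the same size over `ℂ` and
`G ≤ 2^((log₂ m + 2c + 4)^(2c + 4))` (`eq_sum_dets_of_depth_le` + `depth_budget`).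
[cite: HrubesYehudayoff2011, §2] -/
theorem sum_dets_of_shallow_algRepr {n m c s : ℕ} (hnm : n ≤ m)
    (hs : s ≤ 2 ^ ((Nat.log 2 m + c) ^ c))
    {R : Type} [CommRing R] [Algebra ℂ R] [Module.Finite ℂ R] (φ : R →ₐ[ℂ] ℂ)
    (hν : (RingHom.ker φ) ^ ((Nat.log 2 m + c) ^ c) = ⊥) (hR : Module.finrank ℂ R ≤ s)
    (l : R →ₗ[ℂ] ℂ) (A : Matrix (Fin (n ^ c + c)) (Fin (n ^ c + c)) (MvPolynomial (Fin n × Fin n) R))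
    (hA : ∀ i j, (A i j).totalDegree ≤ 1)
    (hf : ∀ d : (Fin n × Fin n) →₀ ℕ, l (coeff d A.det) = coeff d (perPoly (Fin n) ℂ)) :
    ∃ (G : ℕ) (α : Fin G → ℂ)
      (B : Fin G → Matrix (Fin (n ^ c + c)) (Fin (n ^ c + c)) (MvPolynomial (Fin n × Fin n) ℂ)),
      G ≤ 2 ^ ((Nat.log 2 m + (2 * c + 4)) ^ (2 * c + 4)) ∧ (∀ q i j, (B q i j).totalDegree ≤ 1) ∧
        perPoly (Fin n) ℂ = ∑ q, C (α q) * (B q).det := by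
  obtain ⟨G, α, B, hG, hB, hper⟩ := eq_sum_dets_of_depth_le φ hν hR l A hA hf
  have hs1 : 1 ≤ s := by
    have := finrank_ker_character_le (k := ℂ) φ
    have hpos : 0 < Module.finrank ℂ R := by
      haveI : Nontrivial R := ⟨⟨1, 0, fun h10 => one_ne_zero ((map_one φ).symm.trans
        (by rw [h10, map_zero]))⟩⟩
      exact Module.finrank_pos
    omega
  have hN : n ^ c + c ≤ m ^ c + c := Nat.add_le_add_right (Nat.pow_le_pow_left hnm c) c
  refine ⟨G, α, B, ?_, hB, hper⟩
  have h1' : ∀ N : ℕ, N * (s - 1) + 1 ≤ (N + 1) * s := fun N => by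
    have : N * (s - 1) + N = N * s := by
      rw [← Nat.mul_succ, Nat.succ_eq_add_one, Nat.sub_add_cancel hs1]
    nlinarith
  have h1 : (n ^ c + c) * (s - 1) + 1 ≤ (n ^ c + c + 1) * s := h1' (n ^ c + c)
  calc G ≤ ((n ^ c + c) * (s - 1) + 1) ^ ((Nat.log 2 m + c) ^ c - 1) := hG
    _ ≤ ((n ^ c + c + 1) * s) ^ ((Nat.log 2 m + c) ^ c - 1) := Nat.pow_le_pow_left h1 _
    _ ≤ ((n ^ c + c + 1) * s) ^ ((Nat.log 2 m + c) ^ c) :=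
        Nat.pow_le_pow_right (Nat.mul_pos (Nat.succ_pos _) hs1) (Nat.sub_le _ _)
    _ ≤ 2 ^ ((Nat.log 2 m + (2 * c + 4)) ^ (2 * c + 4)) := depth_budget hN hs le_rfl

/-- The same, from the data the crux `AbelianizationQP` starts with: a determinantal expression of
`per_n` of size `m` exists only for `n ≤ m` (degree floor, `not_hasDetRepr_perPoly_of_lt`), so the
hypothesis `n ≤ m` of `sum_dets_of_shallow_algRepr` is automatic in the crux's regime.
[cite: MignonRessayre2004, §1] -/
theorem le_of_hasDetRepr_perPoly {n m : ℕ} (h : HasDetRepr (perPoly (Fin n) ℂ) m) : n ≤ m := by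
  by_contra hlt
  exact not_hasDetRepr_perPoly_of_lt (not_le.mp hlt) h

end Summit.ValiantsHypothesis.ValiantsHypothesis.Theorems.GrenetZeonAbelianizationQP

end
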